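/-
Copyright (c) 2026. All rights reserved.
Released under Apache 2.0 license as described in the file LICENSE.
-/
import Summits.AtomisticToContinuum.Crystallization.Theorems.ChartedZeroExcessLayeredLatticeLiouvilleVV

/-!
# ChartedZeroExcessLayeredLatticeLiouville — part VW «ChainLiouville»: brick (3′) CHAIN LIOUVILLE — the `ℓ^∞`-injectivity of the global banded
  flux-block operator and the uniqueness half of the mode dictionary, typed VERBATIM as the g57 statement of record `ChainLiouvilleShape` and PROVED
  (decomp-a2c-lens-2, g58; helper of stmt-AtomisticToContinuum-26636, leaf (LD′) `ModalLipschitzZ`)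

★★ `flux_injective`: under the tail certificate (`ε < 2κ₀`), a BOUNDED increment field `d : ℤ → E3` solving the homogeneous banded system
`Σ_{|k−m| ≤ ⌊ϱ/c⌋} fluxBlock m k (d k) = 0` through EVERY gap vanishes identically.  Proof (finitary, no limits): compress to the window
`W_L = [-L, L]`; the window operator applied to `d` only sees the RIM (`blockApply_window_eq`: minus the band terms outside the window), so VQ's
window coercivity `(κ₀ − ε/2)·Σ_{W_L} ‖d‖² ≤ Σ_{W_L} ⟪d, blockApply W_L d⟫` bounds the window energy by `2r·R·(2r+1)·fluxConst·τ` whenever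
`‖d n‖ ≤ τ` beyond `L` (`window_sq_sum_le`).  With `τ = R` every finite energy is bounded (`finset_sq_sum_le`), so every level set
`{‖d‖ ≥ t}` is finite (`finite_level_set`), so `d` is eventually `≤ t` (`exists_rim_bound`); feeding `τ = t → 0` back into the window inequality
forces `‖d k‖² ≤ 0`.
★★★ `chainLiouvilleShape_holds : ChainLiouvilleShape` — a chain-Lipschitz profile with zero slope and ZERO COLUMN FLUX through every gap is
constant (the harmonicity hypothesis of the g57 shape is implied by the flux hypothesis and not used): its increments are bounded and solve the
homogeneous banded system (VT `columnFlux_eq`, VP `chainFlux_eq_box` / `chainFlux_eq_sum_fluxBlock`, `boxSlope … 0 = 0`).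
Together with VV (existence) the dictionary (slope `g`, flux `F`) ↔ chain-Lipschitz truncated modes modulo translations is a theorem.
-/

namespace Summit.AtomisticToContinuum.Crystallization.Theorems.ChartedZeroExcessLayeredLatticeLiouville

open Summit.AtomisticToContinuum.Crystallization.Theorems.ChartedPlanarOrderRigidityDoor (E3)
open Finset
open scoped InnerProductSpace RealInnerProductSpace BigOperators

noncomputable section ChainLiouville

variable {c : ℝ} {a b : E3} {w : ℤ → E3}

/-! ### VW.1  The window operator on a global solution: only the rim survives -/

/-- on a solution of the homogeneous banded gap equation at `m`, the window operator returns MINUS the band terms outside the window.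
[formal bookkeeping] -/
theorem blockApply_window_eq (hc : 0 < c) (hL : IsLayeredCrystal c a b w) (ϱ : ℝ) (W : Finset ℤ) {d : ℤ → E3} {m : ℤ}
    (h0 : ∑ k ∈ Icc (m - ⌊ϱ / c⌋₊) (m + ⌊ϱ / c⌋₊), fluxBlock hc hL ϱ m k (d k) = 0) :
    blockApply (fluxBlock hc hL ϱ) W d m = -∑ k ∈ Icc (m - ⌊ϱ / c⌋₊) (m + ⌊ϱ / c⌋₊) with k ∉ W, fluxBlock hc hL ϱ m k (d k) := by
  unfold blockApply
  have h1 : ∑ n ∈ W, fluxBlock hc hL ϱ m n (d n) = ∑ n ∈ Icc (m - ⌊ϱ / c⌋₊) (m + ⌊ϱ / c⌋₊) with n ∈ W, fluxBlock hc hL ϱ m n (d n) := by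
    refine sum_eq_sum_of_vanish (fun k hkW hk => ?_) (fun k hk hkW => ?_)
    · have hk' : k ∉ Icc (m - ⌊ϱ / c⌋₊) (m + ⌊ϱ / c⌋₊) := fun h => hk (mem_filter.mpr ⟨h, hkW⟩)
      rw [fluxBlock_eq_zero_of_not_mem hc hL ϱ hk']
      rfl
    · exact absurd (mem_filter.mp hk).2 hkW
  rw [h1, eq_neg_iff_add_eq_zero, sum_filter_add_sum_filter_not, h0]

/-- … hence it VANISHES at the gaps whose band lies inside the window `[-L, L]`. [formal bookkeeping] -/
theorem blockApply_window_eq_zero (hc : 0 < c) (hL : IsLayeredCrystal c a b w) (ϱ : ℝ) (L : ℕ) {d : ℤ → E3} {m : ℤ}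
    (h0 : ∑ k ∈ Icc (m - ⌊ϱ / c⌋₊) (m + ⌊ϱ / c⌋₊), fluxBlock hc hL ϱ m k (d k) = 0) (hm : m.natAbs + ⌊ϱ / c⌋₊ ≤ L) :
    blockApply (fluxBlock hc hL ϱ) (Icc (-(L : ℤ)) L) d m = 0 := by
  rw [blockApply_window_eq hc hL ϱ _ h0, neg_eq_zero]
  refine sum_eq_zero fun k hk => ?_
  exfalso
  have h1 := (mem_filter.mp hk).1
  rw [mem_Icc] at h1
  exact (mem_filter.mp hk).2 (by rw [mem_Icc]; omega)

/-- … and is bounded by `(2r+1)·fluxConst·τ` at EVERY gap when `‖d n‖ ≤ τ` beyond the window (VP `norm_fluxBlock_le`). [formal bookkeeping] -/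
theorem norm_blockApply_window_le (hc : 0 < c) (hL : IsLayeredCrystal c a b w) {ϱ : ℝ} (hϱ : 0 ≤ ϱ) (L : ℕ) {d : ℤ → E3} {m : ℤ}
    (h0 : ∑ k ∈ Icc (m - ⌊ϱ / c⌋₊) (m + ⌊ϱ / c⌋₊), fluxBlock hc hL ϱ m k (d k) = 0) {τ : ℝ} (hτ0 : 0 ≤ τ)
    (hτ : ∀ n : ℤ, L < n.natAbs → ‖d n‖ ≤ τ) :
    ‖blockApply (fluxBlock hc hL ϱ) (Icc (-(L : ℤ)) L) d m‖ ≤ ((2 * ⌊ϱ / c⌋₊ + 1 : ℕ) : ℝ) * (fluxConst c ϱ * τ) := by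
  have hF := fluxConst_nonneg hc ϱ
  rw [blockApply_window_eq hc hL ϱ _ h0, norm_neg]
  have hterm : ∀ k ∈ (Icc (m - (⌊ϱ / c⌋₊ : ℤ)) (m + ⌊ϱ / c⌋₊)).filter (fun k => k ∉ Icc (-(L : ℤ)) L),
      ‖fluxBlock hc hL ϱ m k (d k)‖ ≤ fluxConst c ϱ * τ := by
    intro k hk
    have hkL : L < k.natAbs := by
      have h := (mem_filter.mp hk).2
      rw [mem_Icc] at h
      omega
    exact ((fluxBlock hc hL ϱ m k).le_opNorm (d k)).trans
      (mul_le_mul (norm_fluxBlock_le hc hL hϱ m k) (hτ k hkL) (norm_nonneg _) hF)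
  have hcard : ((((Icc (m - (⌊ϱ / c⌋₊ : ℤ)) (m + ⌊ϱ / c⌋₊)).filter (fun k => k ∉ Icc (-(L : ℤ)) L)).card : ℕ) : ℝ) ≤
      ((2 * ⌊ϱ / c⌋₊ + 1 : ℕ) : ℝ) := by
    have h := card_filter_le (Icc (m - (⌊ϱ / c⌋₊ : ℤ)) (m + ⌊ϱ / c⌋₊)) (fun k => k ∉ Icc (-(L : ℤ)) L)
    rw [Int.card_Icc] at h
    have h' : (m + ⌊ϱ / c⌋₊ + 1 - (m - ⌊ϱ / c⌋₊)).toNat = 2 * ⌊ϱ / c⌋₊ + 1 := by omega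
    rw [h'] at h
    exact_mod_cast h
  calc ‖∑ k ∈ Icc (m - (⌊ϱ / c⌋₊ : ℤ)) (m + ⌊ϱ / c⌋₊) with k ∉ Icc (-(L : ℤ)) L, fluxBlock hc hL ϱ m k (d k)‖
      ≤ ∑ k ∈ Icc (m - (⌊ϱ / c⌋₊ : ℤ)) (m + ⌊ϱ / c⌋₊) with k ∉ Icc (-(L : ℤ)) L, ‖fluxBlock hc hL ϱ m k (d k)‖ := norm_sum_le _ _
    _ ≤ ((Icc (m - (⌊ϱ / c⌋₊ : ℤ)) (m + ⌊ϱ / c⌋₊)).filter (fun k => k ∉ Icc (-(L : ℤ)) L)).card • (fluxConst c ϱ * τ) :=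
        sum_le_card_nsmul _ _ _ hterm
    _ = (((((Icc (m - (⌊ϱ / c⌋₊ : ℤ)) (m + ⌊ϱ / c⌋₊)).filter (fun k => k ∉ Icc (-(L : ℤ)) L)).card : ℕ) : ℝ)) * (fluxConst c ϱ * τ) :=
        nsmul_eq_mul _ _
    _ ≤ ((2 * ⌊ϱ / c⌋₊ + 1 : ℕ) : ℝ) * (fluxConst c ϱ * τ) := mul_le_mul_of_nonneg_right hcard (mul_nonneg hF hτ0)

/-! ### VW.2  The window energy inequality and its consequences -/

/-- ★ THE WINDOW ENERGY INEQUALITY: for a bounded (`‖d‖ ≤ R`) global solution of the homogeneous banded system with `‖d n‖ ≤ τ` beyond `L`,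
`(κ₀ − ε/2)·Σ_{|m| ≤ L} ‖d m‖² ≤ 2r·R·(2r+1)·fluxConst·τ` (VQ `flux_coercive` on `[-L, L]`: only the `2r` rim gaps contribute). [this file, g58] -/
theorem window_sq_sum_le (hc : 0 < c) (hL : IsLayeredCrystal c a b w) {κ₀ ε ϱ : ℝ} (hϱ : 0 ≤ ϱ) (hε : ε < 2 * κ₀)
    (hK : CoerciveZ (layeredKernel a b w) κ₀)
    (hT : ∀ φ : Cell 2 → ℤ → E3, HasFiniteSupport φ → Summable (tailFam ϱ a b w φ) ∧ ∑' x, tailFam ϱ a b w φ x ≤ ε * nnFormZ φ)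
    {d : ℤ → E3} {R : ℝ} (hR : ∀ k, ‖d k‖ ≤ R)
    (h0 : ∀ m : ℤ, ∑ k ∈ Icc (m - ⌊ϱ / c⌋₊) (m + ⌊ϱ / c⌋₊), fluxBlock hc hL ϱ m k (d k) = 0)
    (L : ℕ) {τ : ℝ} (hτ0 : 0 ≤ τ) (hτ : ∀ n : ℤ, L < n.natAbs → ‖d n‖ ≤ τ) :
    (κ₀ - ε / 2) * ∑ m ∈ Icc (-(L : ℤ)) L, ‖d m‖ ^ 2 ≤
      ((2 * ⌊ϱ / c⌋₊ : ℕ) : ℝ) * (R * (((2 * ⌊ϱ / c⌋₊ + 1 : ℕ) : ℝ) * (fluxConst c ϱ * τ))) := by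
  have hF := fluxConst_nonneg hc ϱ
  have hR0 : 0 ≤ R := (norm_nonneg _).trans (hR 0)
  have hQ0 : 0 ≤ ((2 * ⌊ϱ / c⌋₊ + 1 : ℕ) : ℝ) * (fluxConst c ϱ * τ) := by positivity
  refine (flux_coercive hc hL hϱ hε.le hK hT (Icc (-(L : ℤ)) L) d).trans ?_
  have hzero : ∀ m ∈ (Icc (-(L : ℤ)) L).filter (fun m : ℤ => m.natAbs + ⌊ϱ / c⌋₊ ≤ L),
      ‖d m‖ * ‖blockApply (fluxBlock hc hL ϱ) (Icc (-(L : ℤ)) L) d m‖ = 0 := fun m hm => by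
    rw [blockApply_window_eq_zero hc hL ϱ L (h0 m) (mem_filter.mp hm).2, norm_zero, mul_zero]
  have hcard : ((((Icc (-(L : ℤ)) L).filter (fun m : ℤ => ¬ (m.natAbs + ⌊ϱ / c⌋₊ ≤ L))).card : ℕ) : ℝ) ≤ ((2 * ⌊ϱ / c⌋₊ : ℕ) : ℝ) := by
    have hsub : (Icc (-(L : ℤ)) L).filter (fun m : ℤ => ¬ (m.natAbs + ⌊ϱ / c⌋₊ ≤ L)) ⊆
        Icc (-(L : ℤ)) (-(L : ℤ) + ⌊ϱ / c⌋₊ - 1) ∪ Icc ((L : ℤ) - ⌊ϱ / c⌋₊ + 1) L := by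
      intro m hm
      have h1 := (mem_filter.mp hm).1
      have h2 := (mem_filter.mp hm).2
      rw [mem_Icc] at h1
      rw [mem_union, mem_Icc, mem_Icc]
      omega
    have h := (card_le_card hsub).trans (card_union_le _ _)
    rw [Int.card_Icc, Int.card_Icc] at h
    have e1 : (-(L : ℤ) + ⌊ϱ / c⌋₊ - 1 + 1 - -(L : ℤ)).toNat = ⌊ϱ / c⌋₊ := by omega
    have e2 : ((L : ℤ) + 1 - ((L : ℤ) - ⌊ϱ / c⌋₊ + 1)).toNat = ⌊ϱ / c⌋₊ := by omega
    rw [e1, e2] at h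
    have h' : ((Icc (-(L : ℤ)) L).filter (fun m : ℤ => ¬ (m.natAbs + ⌊ϱ / c⌋₊ ≤ L))).card ≤ 2 * ⌊ϱ / c⌋₊ := by omega
    exact_mod_cast h'
  calc ∑ m ∈ Icc (-(L : ℤ)) L, ⟪d m, blockApply (fluxBlock hc hL ϱ) (Icc (-(L : ℤ)) L) d m⟫_ℝ
      ≤ ∑ m ∈ Icc (-(L : ℤ)) L, ‖d m‖ * ‖blockApply (fluxBlock hc hL ϱ) (Icc (-(L : ℤ)) L) d m‖ :=
        sum_le_sum fun m _ => real_inner_le_norm _ _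
    _ = ∑ m ∈ Icc (-(L : ℤ)) L with ¬ (m.natAbs + ⌊ϱ / c⌋₊ ≤ L), ‖d m‖ * ‖blockApply (fluxBlock hc hL ϱ) (Icc (-(L : ℤ)) L) d m‖ := by
        rw [← sum_filter_add_sum_filter_not (Icc (-(L : ℤ)) L) (fun m : ℤ => m.natAbs + ⌊ϱ / c⌋₊ ≤ L), sum_eq_zero hzero, zero_add]
    _ ≤ ∑ m ∈ Icc (-(L : ℤ)) L with ¬ (m.natAbs + ⌊ϱ / c⌋₊ ≤ L), R * (((2 * ⌊ϱ / c⌋₊ + 1 : ℕ) : ℝ) * (fluxConst c ϱ * τ)) :=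
        sum_le_sum fun m _ => mul_le_mul (hR m) (norm_blockApply_window_le hc hL hϱ L (h0 m) hτ0 hτ) (norm_nonneg _) hR0
    _ = ((((Icc (-(L : ℤ)) L).filter (fun m : ℤ => ¬ (m.natAbs + ⌊ϱ / c⌋₊ ≤ L))).card : ℕ) : ℝ) *
          (R * (((2 * ⌊ϱ / c⌋₊ + 1 : ℕ) : ℝ) * (fluxConst c ϱ * τ))) := by rw [sum_const, nsmul_eq_mul]
    _ ≤ ((2 * ⌊ϱ / c⌋₊ : ℕ) : ℝ) * (R * (((2 * ⌊ϱ / c⌋₊ + 1 : ℕ) : ℝ) * (fluxConst c ϱ * τ))) :=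
        mul_le_mul_of_nonneg_right hcard (mul_nonneg hR0 hQ0)

/-- EVERY FINITE ENERGY IS BOUNDED: `(κ₀ − ε/2)·Σ_{m ∈ A} ‖d m‖² ≤ 2r·R·(2r+1)·fluxConst·R` for every finite set of gaps `A` (the window inequality
with `τ = R`). [formal bookkeeping] -/
theorem finset_sq_sum_le (hc : 0 < c) (hL : IsLayeredCrystal c a b w) {κ₀ ε ϱ : ℝ} (hϱ : 0 ≤ ϱ) (hε : ε < 2 * κ₀)
    (hK : CoerciveZ (layeredKernel a b w) κ₀)
    (hT : ∀ φ : Cell 2 → ℤ → E3, HasFiniteSupport φ → Summable (tailFam ϱ a b w φ) ∧ ∑' x, tailFam ϱ a b w φ x ≤ ε * nnFormZ φ)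
    {d : ℤ → E3} {R : ℝ} (hR : ∀ k, ‖d k‖ ≤ R)
    (h0 : ∀ m : ℤ, ∑ k ∈ Icc (m - ⌊ϱ / c⌋₊) (m + ⌊ϱ / c⌋₊), fluxBlock hc hL ϱ m k (d k) = 0) (A : Finset ℤ) :
    (κ₀ - ε / 2) * ∑ m ∈ A, ‖d m‖ ^ 2 ≤ ((2 * ⌊ϱ / c⌋₊ : ℕ) : ℝ) * (R * (((2 * ⌊ϱ / c⌋₊ + 1 : ℕ) : ℝ) * (fluxConst c ϱ * R))) := by
  have hR0 : 0 ≤ R := (norm_nonneg _).trans (hR 0)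
  have hδ : 0 ≤ κ₀ - ε / 2 := by linarith
  obtain ⟨L, hLA⟩ : ∃ L : ℕ, ∀ m ∈ A, m.natAbs ≤ L := ⟨A.sup Int.natAbs, fun m hm => le_sup (f := Int.natAbs) hm⟩
  have hsub : A ⊆ Icc (-(L : ℤ)) L := fun m hm => by
    have h := hLA m hm
    rw [mem_Icc]
    omega
  calc (κ₀ - ε / 2) * ∑ m ∈ A, ‖d m‖ ^ 2 ≤ (κ₀ - ε / 2) * ∑ m ∈ Icc (-(L : ℤ)) L, ‖d m‖ ^ 2 :=
        mul_le_mul_of_nonneg_left (sum_le_sum_of_subset_of_nonneg hsub fun m _ _ => sq_nonneg _) hδ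
    _ ≤ ((2 * ⌊ϱ / c⌋₊ : ℕ) : ℝ) * (R * (((2 * ⌊ϱ / c⌋₊ + 1 : ℕ) : ℝ) * (fluxConst c ϱ * R))) :=
        window_sq_sum_le hc hL hϱ hε hK hT hR h0 L hR0 fun n _ => hR n

/-- EVERY LEVEL SET IS FINITE: for `t > 0`, only finitely many gaps carry `‖d m‖ ≥ t` (an infinite level set would contain a finite subset whose energy
exceeds the bound of `finset_sq_sum_le`). [formal bookkeeping] -/
theorem finite_level_set (hc : 0 < c) (hL : IsLayeredCrystal c a b w) {κ₀ ε ϱ : ℝ} (hϱ : 0 ≤ ϱ) (hε : ε < 2 * κ₀)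
    (hK : CoerciveZ (layeredKernel a b w) κ₀)
    (hT : ∀ φ : Cell 2 → ℤ → E3, HasFiniteSupport φ → Summable (tailFam ϱ a b w φ) ∧ ∑' x, tailFam ϱ a b w φ x ≤ ε * nnFormZ φ)
    {d : ℤ → E3} {R : ℝ} (hR : ∀ k, ‖d k‖ ≤ R)
    (h0 : ∀ m : ℤ, ∑ k ∈ Icc (m - ⌊ϱ / c⌋₊) (m + ⌊ϱ / c⌋₊), fluxBlock hc hL ϱ m k (d k) = 0) {t : ℝ} (ht : 0 < t) :
    Set.Finite {m : ℤ | t ≤ ‖d m‖} := by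
  by_contra hinf
  have hδ : 0 < κ₀ - ε / 2 := by linarith
  set K : ℝ := ((2 * ⌊ϱ / c⌋₊ : ℕ) : ℝ) * (R * (((2 * ⌊ϱ / c⌋₊ + 1 : ℕ) : ℝ) * (fluxConst c ϱ * R))) with hK0
  obtain ⟨A, hA, hcard⟩ := Set.Infinite.exists_subset_card_eq hinf (⌊K / ((κ₀ - ε / 2) * t ^ 2)⌋₊ + 1)
  have h1 : (κ₀ - ε / 2) * ∑ m ∈ A, ‖d m‖ ^ 2 ≤ K := finset_sq_sum_le hc hL hϱ hε hK hT hR h0 A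
  have h2 : ((A.card : ℕ) : ℝ) * t ^ 2 ≤ ∑ m ∈ A, ‖d m‖ ^ 2 := by
    rw [← nsmul_eq_mul, ← sum_const]
    exact sum_le_sum fun m hm => pow_le_pow_left₀ ht.le (hA (mem_coe.mpr hm)) 2
  have h3 : K < ((A.card : ℕ) : ℝ) * ((κ₀ - ε / 2) * t ^ 2) := by
    have h := Nat.lt_floor_add_one (K / ((κ₀ - ε / 2) * t ^ 2))
    rw [div_lt_iff₀ (by positivity)] at h
    rw [hcard]
    exact_mod_cast h
  have h4 : ((A.card : ℕ) : ℝ) * ((κ₀ - ε / 2) * t ^ 2) ≤ (κ₀ - ε / 2) * ∑ m ∈ A, ‖d m‖ ^ 2 := by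
    have h := mul_le_mul_of_nonneg_left h2 hδ.le
    linarith
  linarith

/-- … hence `d` is EVENTUALLY SMALL: for `t > 0` there is `L₀` with `‖d n‖ ≤ t` for `|n| > L₀`. [formal bookkeeping] -/
theorem exists_rim_bound (hc : 0 < c) (hL : IsLayeredCrystal c a b w) {κ₀ ε ϱ : ℝ} (hϱ : 0 ≤ ϱ) (hε : ε < 2 * κ₀)
    (hK : CoerciveZ (layeredKernel a b w) κ₀)
    (hT : ∀ φ : Cell 2 → ℤ → E3, HasFiniteSupport φ → Summable (tailFam ϱ a b w φ) ∧ ∑' x, tailFam ϱ a b w φ x ≤ ε * nnFormZ φ)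
    {d : ℤ → E3} {R : ℝ} (hR : ∀ k, ‖d k‖ ≤ R)
    (h0 : ∀ m : ℤ, ∑ k ∈ Icc (m - ⌊ϱ / c⌋₊) (m + ⌊ϱ / c⌋₊), fluxBlock hc hL ϱ m k (d k) = 0) {t : ℝ} (ht : 0 < t) :
    ∃ L₀ : ℕ, ∀ n : ℤ, L₀ < n.natAbs → ‖d n‖ ≤ t := by
  have hfin := finite_level_set hc hL hϱ hε hK hT hR h0 ht
  refine ⟨hfin.toFinset.sup Int.natAbs, fun n hn => ?_⟩
  by_contra hlt
  have hmem : n ∈ hfin.toFinset := hfin.mem_toFinset.mpr (not_le.mp hlt).le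
  exact absurd (le_sup (f := Int.natAbs) hmem) (not_le.mpr hn)

/-! ### VW.3  ★★ Injectivity of the global flux-block operator on bounded increment fields -/

/-- ★★ `ℓ^∞`-INJECTIVITY OF THE GLOBAL FLUX-BLOCK OPERATOR: under the tail certificate (`ε < 2κ₀`), a bounded increment field solving the homogeneous
banded system `Σ_{|k−m| ≤ ⌊ϱ/c⌋} fluxBlock m k (d k) = 0` through every gap is identically zero. [this file, g58] -/
theorem flux_injective (hc : 0 < c) (hL : IsLayeredCrystal c a b w) {κ₀ ε ϱ : ℝ} (hϱ : 0 ≤ ϱ) (hε : ε < 2 * κ₀)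
    (hK : CoerciveZ (layeredKernel a b w) κ₀)
    (hT : ∀ φ : Cell 2 → ℤ → E3, HasFiniteSupport φ → Summable (tailFam ϱ a b w φ) ∧ ∑' x, tailFam ϱ a b w φ x ≤ ε * nnFormZ φ)
    {d : ℤ → E3} {R : ℝ} (hR : ∀ k, ‖d k‖ ≤ R)
    (h0 : ∀ m : ℤ, ∑ k ∈ Icc (m - ⌊ϱ / c⌋₊) (m + ⌊ϱ / c⌋₊), fluxBlock hc hL ϱ m k (d k) = 0) (k : ℤ) : d k = 0 := by
  have hδ : 0 < κ₀ - ε / 2 := by linarith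
  have hF := fluxConst_nonneg hc ϱ
  have hR0 : 0 ≤ R := (norm_nonneg _).trans (hR 0)
  set K₁ : ℝ := ((2 * ⌊ϱ / c⌋₊ : ℕ) : ℝ) * (R * (((2 * ⌊ϱ / c⌋₊ + 1 : ℕ) : ℝ) * fluxConst c ϱ)) with hK₁
  have hK₁0 : 0 ≤ K₁ := by positivity
  have hsq : (κ₀ - ε / 2) * ‖d k‖ ^ 2 ≤ 0 := by
    refine le_of_forall_pos_le_add fun η hη => ?_
    have hτ0 : 0 < η / (K₁ + 1) := by positivity
    obtain ⟨L₀, hL₀⟩ := exists_rim_bound hc hL hϱ hε hK hT hR h0 hτ0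
    obtain ⟨L, hL1, hL2⟩ : ∃ L : ℕ, L₀ ≤ L ∧ k.natAbs ≤ L := ⟨max L₀ k.natAbs, le_max_left _ _, le_max_right _ _⟩
    have hk : k ∈ Icc (-(L : ℤ)) L := by rw [mem_Icc]; omega
    have h1 : (κ₀ - ε / 2) * ‖d k‖ ^ 2 ≤ (κ₀ - ε / 2) * ∑ m ∈ Icc (-(L : ℤ)) L, ‖d m‖ ^ 2 :=
      mul_le_mul_of_nonneg_left (single_le_sum (f := fun m => ‖d m‖ ^ 2) (fun m _ => sq_nonneg ‖d m‖) hk) hδ.le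
    have h2 := window_sq_sum_le hc hL hϱ hε hK hT hR h0 L hτ0.le fun n hn => hL₀ n (by omega)
    have h3 : ((2 * ⌊ϱ / c⌋₊ : ℕ) : ℝ) * (R * (((2 * ⌊ϱ / c⌋₊ + 1 : ℕ) : ℝ) * (fluxConst c ϱ * (η / (K₁ + 1))))) =
        η * (K₁ / (K₁ + 1)) := by
      rw [hK₁]
      ring
    have h4 : η * (K₁ / (K₁ + 1)) ≤ η := mul_le_of_le_one_right hη.le (div_le_one_of_le₀ (by linarith) (by positivity))
    linarith
  have hsq' : ‖d k‖ ^ 2 ≤ 0 := by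
    by_contra h
    have h' : 0 < (κ₀ - ε / 2) * ‖d k‖ ^ 2 := mul_pos hδ (not_le.mp h)
    linarith
  have hn : ‖d k‖ = 0 := by nlinarith [norm_nonneg (d k), sq_nonneg ‖d k‖]
  exact norm_eq_zero.mp hn

/-! ### VW.4  ★★★ Chain Liouville -/

/-- the slope block of the zero slope vanishes. [formal bookkeeping] -/
theorem slopeK_zero (ϱ : ℝ) (a b : E3) (w : ℤ → E3) (X : Cell 2 × ℤ) (β : ℤ) : slopeK ϱ a b w X β 0 = 0 := by
  have h0 : ∀ Y : Cell 2 × ℤ, nearK ϱ a b w X Y 0 = 0 := fun Y => by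
    unfold nearK
    split_ifs <;> simp
  unfold slopeK
  simp only [Pi.zero_apply, smul_zero, sum_const_zero, h0, finsum_zero]

/-- the box slope flux of the zero slope vanishes. [formal bookkeeping] -/
theorem boxSlope_zero (ϱ : ℝ) (a b : E3) (w : ℤ → E3) (r : ℕ) (m : ℤ) : boxSlope ϱ a b w r 0 m = 0 := by
  unfold boxSlope
  simp only [slopeK_zero, sum_const_zero]

/-- ZERO COLUMN FLUX ⟹ the increments solve the homogeneous banded flux-block system (VT `columnFlux_eq`, VP `chainFlux_eq_box`,
`chainFlux_eq_sum_fluxBlock`). [formal bookkeeping] -/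
theorem sum_fluxBlock_eq_zero_of_columnFlux (hc : 0 < c) (hL : IsLayeredCrystal c a b w) (ϱ : ℝ) (cf : ℤ → E3)
    (hflux : ∀ m : ℤ, columnFlux ϱ a b w ⌊ϱ / c⌋₊ 0 cf m = 0) (m : ℤ) :
    ∑ k ∈ Icc (m - ⌊ϱ / c⌋₊) (m + ⌊ϱ / c⌋₊), fluxBlock hc hL ϱ m k (cf (k + 1) - cf k) = 0 := by
  have e := hflux m
  rw [columnFlux_eq, boxSlope_zero, add_zero, ← chainFlux_eq_box hc hL cf (Subset.refl _),
    chainFlux_eq_sum_fluxBlock hc hL cf (Subset.refl _)] at e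
  exact e

/-- (3′) CHAIN LIOUVILLE — the statement shape of record (g57 `sketch_ModeExtraction.lean`, VERBATIM): the uniqueness half (modes modulo
translations ↔ (slope, flux)): a zero-slope, zero-flux, chain-Lipschitz solution of the recursion is constant. [g57 sketch; this file, g58] -/
def ChainLiouvilleShape : Prop :=
  TailDominationCert → ∀ κ₀ > (0 : ℝ), ∀ c₀ > (0 : ℝ), ∃ ϱ₁ ≥ (1 : ℝ), ∀ ϱ ≥ ϱ₁, ∀ (a b : E3) (w : ℤ → E3),
    IsLayeredCrystal c₀ a b w → CoerciveZ (layeredKernel a b w) κ₀ →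
      ∀ cf : ℤ → E3, IsTruncHarmonicZ ϱ a b w (fun _ α => cf α) Set.univ →
        (∃ m : ℝ, ∀ α β : ℤ, ‖cf β - cf α‖ ≤ m * |(((β - α : ℤ)) : ℝ)|) →
        (∀ m : ℤ, columnFlux ϱ a b w ⌊ϱ / c₀⌋₊ 0 cf m = 0) → ∀ α : ℤ, cf (α + 1) = cf α

/-- ★★★ (3′) CHAIN LIOUVILLE HOLDS, with `ϱ₁ = max 1 ϱ₀(c₀, κ₀)` from the tail certificate at `ε = κ₀` (the harmonicity hypothesis is implied by the
flux hypothesis and is not used). [this file, g58] -/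
theorem chainLiouvilleShape_holds : ChainLiouvilleShape := by
  intro hTD κ₀ hκ₀ c₀ hc₀
  obtain ⟨ϱ₀, _, hTail⟩ := hTD c₀ hc₀ κ₀ hκ₀
  refine ⟨max 1 ϱ₀, le_max_left _ _, ?_⟩
  intro ϱ hϱ a b w hL hK cf _ hlip hflux α
  obtain ⟨m₀, hm₀⟩ := hlip
  have hϱ0 : 0 ≤ ϱ := zero_le_one.trans ((le_max_left _ _).trans hϱ)
  have hϱ₀ϱ : ϱ₀ ≤ ϱ := (le_max_right _ _).trans hϱ
  have hε : κ₀ < 2 * κ₀ := by linarith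
  have hT : ∀ φ : Cell 2 → ℤ → E3, HasFiniteSupport φ →
      Summable (tailFam ϱ a b w φ) ∧ ∑' x, tailFam ϱ a b w φ x ≤ κ₀ * nnFormZ φ :=
    fun φ hφ => hTail ϱ hϱ₀ϱ a b w hL φ hφ
  have hR : ∀ k : ℤ, ‖cf (k + 1) - cf k‖ ≤ m₀ := fun k => by
    have h := hm₀ k (k + 1)
    rw [add_sub_cancel_left, Int.cast_one, abs_one, mul_one] at h
    exact h
  have h := flux_injective hc₀ hL hϱ0 hε hK hT hR (sum_fluxBlock_eq_zero_of_columnFlux hc₀ hL ϱ cf hflux) α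
  exact sub_eq_zero.mp h

end ChainLiouville

end Summit.AtomisticToContinuum.Crystallization.Theorems.ChartedZeroExcessLayeredLatticeLiouville
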